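import Mathlib
import HarnessLib
import Summits.HubbardSuperconductivity.HubbardSuperconductivity.Theorems.KLProgrammeKLRegimeCountertermJacksonLowPart
import Summits.HubbardSuperconductivity.HubbardSuperconductivity.Theorems.KLProgrammeKLRegimeCountertermJacksonHighPart
import Summits.HubbardSuperconductivity.HubbardSuperconductivity.Theorems.KLProgrammeKLRegimeCountertermMultiSlotSelfMap
import Summits.HubbardSuperconductivity.HubbardSuperconductivity.Theorems.KLProgrammeKLRegimeCountertermProfileSymmetry
import Summits.HubbardSuperconductivity.HubbardSuperconductivity.Theorems.KLProgrammeKLRegimeSplitFrameFn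
import Summits.HubbardSuperconductivity.HubbardSuperconductivity.Theorems.KLProgrammeKLRegimeSplitFermiPointSmooth

/-!
# Route `KLProgramme`, crux K3 — gen-5 ENGINE child (stmt-…-19918, `stub_twoLeg_step`, clause `TwoLegSizesMST`), recipe (L)+(F):
# THE CHAIN OF FRAMES of the (E3a-MS) witness and the TELESCOPED ANGULAR PROFILES (structural layer (P4-b))

Seat hubbard-kl-k3c3-p1 (g3); MS-DESIGN-NOTE §3 (evidence #29 on 19855), plan g12 STATUS l.1769.  Given a frame `K` with pieces `Kp m` (`m ≤ N`,
`K = Σ Kp m` pointwise — FrameOK (ii)), a scale `n` and a cut degree `d` (= `4ⁿ` in the witness):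
* each deep piece is anchored at its value at the origin, `c_m := (Kp m)(0)`, `Kp m° := Kp m − c_m` (so `sup|Kp m°| ≤ 2·sup|Kp m|` and all derivatives
  agree) — (L): the constants ride INSIDE the base frame, no level-shift identity is needed;
* `lowPart d P := jlowFrame d (P − P(0))` (a `TrigPolyC4v`, `…JacksonLowPart`), `highPart d P := (P − P(0)) ⊖ lowPart d P` (value = `jhigh d (P − P(0))`,
  `…JacksonHighPart`) — (F);
* the BASE frame `msBase d Kp n N := Σ_{m ≤ n} Kp m ⊕ const(Σ_{m ∈ Ioc n N} c_m) ⊕ Σ_{m ∈ Ioc n N} lowPart d (Kp m)` and the CHAIN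
  `msChain d Kp n N k := msBase ⊕ Σ_{m ∈ Ioc n (n+k)} highPart d (Kp m)` (`k = 0 … N − n`), whose last frame has the VALUES of `K`
  (`eval_msChain_last`), hence the same Fermi curve (`klFermiPoint_msChain_last`);
* the PROFILES `msProfile … m` : `m = n ↦ F∘γ[msChain 0]`, `m ∈ Ioc n N ↦ F∘γ[msChain (m−n)] − F∘γ[msChain (m−n−1)]`, else `0`, for a symbol
  `F = evalM S` (`S : TrigPolyC4v`, e.g. the increment interpolant `symInterp L Δσ_n`), with the TELESCOPING `F∘γ[K] = msProfile n + Σ_{Ioc} msProfile m`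
  (`msProfile_split`) and their frame symmetries (`msProfile_periodic/_even/_diag`) — exactly the hypotheses `hsplit/hper/heven/hdiag` of
  `twoLegSizesMST_of_profile_split` (`…TwoLegSizesMSOfProfileSplit`).

Definitions + structural identities only (review lane); the analytic sizes of the profiles ((P4-c): k3c3-p3's P2-INTERFACE + the Jackson bounds) and
the fits are the remaining step.  Nothing about the model is asserted.
-/

noncomputable section

namespace Summit.HubbardSuperconductivity.HubbardSuperconductivity.Theorems.KLRegimeSplit

set_option linter.dupNamespace false -- summit = problem name (single-conjunct summit), D-0017

open Real Finset Literature.MathematicalPhysics.QuantumLattice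

/-- A `TrigPolyC4v` is continuous as a function. -/
theorem continuous_trigPoly_eval (P : TrigPolyC4v) : Continuous P.eval :=
  (TrigPolyC4v.contDiff_eval P (n := 0)).continuous

/-! ## §1 Constant frames, anchored pieces, low and high parts -/

/-- The constant frame `c` (degree `0`, coefficient of `h₀₀ = 1`). -/
def msConst (c : ℝ) : TrigPolyC4v := ⟨0, fun _ _ => c⟩

/-- `(msConst c)(p) = c`. -/
@[simp] theorem eval_msConst (c : ℝ) (p : Fin 2 → ℝ) : (msConst c).eval p = c := by
  simp [msConst, TrigPolyC4v.eval_def]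

/-- The anchored piece `P° := P ⊖ P(0)`. -/
def msAnchor (P : TrigPolyC4v) : TrigPolyC4v := fsub P (msConst (P.eval 0))

/-- `P°(p) = P(p) − P(0)`. -/
theorem eval_msAnchor (P : TrigPolyC4v) (p : Fin 2 → ℝ) : (msAnchor P).eval p = P.eval p - P.eval 0 := by
  simp [msAnchor, eval_fsub]

/-- **The LOW part of a piece**: `jlowFrame d (P°)`. -/
def lowPart (d : ℕ) (P : TrigPolyC4v) : TrigPolyC4v := jlowFrame d (msAnchor P).eval

/-- **The HIGH part of a piece**: `P° ⊖ lowPart d P`. -/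
def highPart (d : ℕ) (P : TrigPolyC4v) : TrigPolyC4v := fsub (msAnchor P) (lowPart d P)

/-- `lowPart d P` evaluates to `jlow d (P°)`. -/
theorem eval_lowPart (d : ℕ) (P : TrigPolyC4v) (p : Fin 2 → ℝ) : (lowPart d P).eval p = jlow d (msAnchor P).eval p := by
  have hs := isSymmetricFrame_eval (msAnchor P)
  exact eval_jlowFrame d (continuous_trigPoly_eval _) hs.1 hs.2.1 hs.2.2 p

/-- `highPart d P` evaluates to `jhigh d (P°)`. -/
theorem eval_highPart (d : ℕ) (P : TrigPolyC4v) (p : Fin 2 → ℝ) : (highPart d P).eval p = jhigh d (msAnchor P).eval p := by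
  rw [highPart, eval_fsub, eval_lowPart]
  have h := jlow_add_jhigh d (continuous_trigPoly_eval (msAnchor P)) (continuous_jsmooth d (continuous_trigPoly_eval _)) p
  linarith

/-- **Low + high + anchor = piece**: `c + lowPart(p) + highPart(p) = P(p)` with `c = P(0)`. -/
theorem eval_lowPart_add_highPart (d : ℕ) (P : TrigPolyC4v) (p : Fin 2 → ℝ) :
    P.eval 0 + ((lowPart d P).eval p + (highPart d P).eval p) = P.eval p := by
  rw [highPart, eval_fsub, eval_msAnchor]; ring

/-! ## §2 Sums over `Ioc n N`, the base frame and the chain -/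

/-- The frame `Σ_{m ∈ Ioc n N} f m` (as `fsumR` over the shifted index). -/
def fsumIoc (f : ℕ → TrigPolyC4v) (n N : ℕ) : TrigPolyC4v := fsumR (fun i => f (n + 1 + i)) (N - n)

/-- `(Σ_{m ∈ Ioc n N} f m)(p) = Σ_{m ∈ Ioc n N} (f m)(p)` for `n ≤ N`. -/
theorem eval_fsumIoc (f : ℕ → TrigPolyC4v) {n N : ℕ} (hnN : n ≤ N) (p : Fin 2 → ℝ) :
    (fsumIoc f n N).eval p = ∑ m ∈ Ioc n N, (f m).eval p := by
  rw [fsumIoc, eval_fsumR, (show Ioc n N = Ico (n + 1) (N + 1) by ext m; simp only [Finset.mem_Ioc, Finset.mem_Ico]; omega), Finset.sum_Ico_eq_sum_range]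
  have e : N + 1 - (n + 1) = N - n := by omega
  rw [e]

/-- **The BASE frame**: `Σ_{m ≤ n} Kp m ⊕ const(Σ_{m ∈ Ioc n N} c_m) ⊕ Σ_{m ∈ Ioc n N} lowPart d (Kp m)`. -/
def msBase (d : ℕ) (Kp : ℕ → TrigPolyC4v) (n N : ℕ) : TrigPolyC4v :=
  fadd (fadd (fsumR Kp (n + 1)) (msConst (∑ m ∈ Ioc n N, (Kp m).eval 0))) (fsumIoc (fun m => lowPart d (Kp m)) n N)

/-- **The CHAIN**: `msChain k := msBase ⊕ Σ_{m ∈ Ioc n (n + k)} highPart d (Kp m)`. -/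
def msChain (d : ℕ) (Kp : ℕ → TrigPolyC4v) (n N k : ℕ) : TrigPolyC4v :=
  fadd (msBase d Kp n N) (fsumIoc (fun m => highPart d (Kp m)) n (n + k))

/-- The values of the base frame. -/
theorem eval_msBase (d : ℕ) (Kp : ℕ → TrigPolyC4v) {n N : ℕ} (hnN : n ≤ N) (p : Fin 2 → ℝ) :
    (msBase d Kp n N).eval p = ∑ m ∈ range (n + 1), (Kp m).eval p + ∑ m ∈ Ioc n N, (Kp m).eval 0 +
      ∑ m ∈ Ioc n N, (lowPart d (Kp m)).eval p := by
  rw [msBase, eval_fadd, eval_fadd, eval_fsumR, eval_msConst, eval_fsumIoc _ hnN]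

/-- The values along the chain. -/
theorem eval_msChain (d : ℕ) (Kp : ℕ → TrigPolyC4v) (n N k : ℕ) (p : Fin 2 → ℝ) :
    (msChain d Kp n N k).eval p = (msBase d Kp n N).eval p + ∑ m ∈ Ioc n (n + k), (highPart d (Kp m)).eval p := by
  rw [msChain, eval_fadd, eval_fsumIoc _ (by omega)]

/-- The chain starts at the base. -/
theorem eval_msChain_zero (d : ℕ) (Kp : ℕ → TrigPolyC4v) (n N : ℕ) (p : Fin 2 → ℝ) :
    (msChain d Kp n N 0).eval p = (msBase d Kp n N).eval p := by
  rw [eval_msChain]; simp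

/-- One chain step adds one high part. -/
theorem eval_msChain_succ (d : ℕ) (Kp : ℕ → TrigPolyC4v) (n N k : ℕ) (p : Fin 2 → ℝ) :
    (msChain d Kp n N (k + 1)).eval p = (msChain d Kp n N k).eval p + (highPart d (Kp (n + k + 1))).eval p := by
  rw [eval_msChain, eval_msChain, show n + (k + 1) = n + k + 1 by ring, Finset.sum_Ioc_succ_top (by omega)]
  ring

/-- **The last frame of the chain has the values of `K`**: with `K(p) = Σ_{m ≤ N} (Kp m)(p)` and `n ≤ N`,
`(msChain (N − n))(p) = K(p)`. -/
theorem eval_msChain_last (d : ℕ) {K : TrigPolyC4v} {Kp : ℕ → TrigPolyC4v} {N : ℕ}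
    (hK : ∀ p : Fin 2 → ℝ, K.eval p = ∑ m ∈ range (N + 1), (Kp m).eval p) {n : ℕ} (hnN : n ≤ N) (p : Fin 2 → ℝ) :
    (msChain d Kp n N (N - n)).eval p = K.eval p := by
  rw [eval_msChain, eval_msBase d Kp hnN, show n + (N - n) = N by omega, hK p]
  have hsplit : ∑ m ∈ range (N + 1), (Kp m).eval p = ∑ m ∈ range (n + 1), (Kp m).eval p + ∑ m ∈ Ioc n N, (Kp m).eval p := by
    rw [(show Ioc n N = Ico (n + 1) (N + 1) by ext m; simp only [Finset.mem_Ioc, Finset.mem_Ico]; omega), Finset.sum_Ico_eq_sub _ (by omega : n + 1 ≤ N + 1), Finset.range_eq_Ico]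
    ring
  rw [hsplit]
  have hpieces : ∑ m ∈ Ioc n N, (Kp m).eval p =
      ∑ m ∈ Ioc n N, ((Kp m).eval 0 + ((lowPart d (Kp m)).eval p + (highPart d (Kp m)).eval p)) :=
    Finset.sum_congr rfl fun m _ => (eval_lowPart_add_highPart d (Kp m) p).symm
  rw [hpieces, Finset.sum_add_distrib, Finset.sum_add_distrib]
  ring

/-- **Hence the last frame of the chain has the Fermi curve of `K`.** -/
theorem klFermiPoint_msChain_last (d : ℕ) {K : TrigPolyC4v} {Kp : ℕ → TrigPolyC4v} {N : ℕ}
    (hK : ∀ p : Fin 2 → ℝ, K.eval p = ∑ m ∈ range (N + 1), (Kp m).eval p) {n : ℕ} (hnN : n ≤ N) (μ : ℝ) :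
    klFermiPoint μ (msChain d Kp n N (N - n)) = klFermiPoint μ K := by
  funext θ
  unfold klFermiPoint
  have h : (fun p : Fin 2 → ℝ => -(msChain d Kp n N (N - n)).eval p) = fun p => -K.eval p :=
    funext fun p => by rw [eval_msChain_last d hK hnN]
  rw [h]

/-! ## §3 The telescoped profiles -/

/-- A symbol read along the Fermi curve of a frame: `θ ↦ S(k_F^C(θ))`. -/
def curveProfile (μ : ℝ) (S C : TrigPolyC4v) (θ : ℝ) : ℝ := S.eval (klFermiPoint μ C θ)

/-- **The profiles of the witness**: `n ↦ S∘γ[msChain 0]`, `m ∈ Ioc n N ↦ S∘γ[msChain (m−n)] − S∘γ[msChain (m−n−1)]`, else `0`. -/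
def msProfile (μ : ℝ) (S : TrigPolyC4v) (d : ℕ) (Kp : ℕ → TrigPolyC4v) (n N m : ℕ) (θ : ℝ) : ℝ :=
  if m = n then curveProfile μ S (msChain d Kp n N 0) θ
  else if m ∈ Ioc n N then curveProfile μ S (msChain d Kp n N (m - n)) θ - curveProfile μ S (msChain d Kp n N (m - n - 1)) θ
  else 0

/-- **TELESCOPING**: `S∘γ[K] = msProfile n + Σ_{m ∈ Ioc n N} msProfile m`. -/
theorem msProfile_split (μ : ℝ) (S : TrigPolyC4v) (d : ℕ) {K : TrigPolyC4v} {Kp : ℕ → TrigPolyC4v} {N : ℕ}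
    (hK : ∀ p : Fin 2 → ℝ, K.eval p = ∑ m ∈ range (N + 1), (Kp m).eval p) {n : ℕ} (hnN : n ≤ N) (θ : ℝ) :
    curveProfile μ S K θ = msProfile μ S d Kp n N n θ + ∑ m ∈ Ioc n N, msProfile μ S d Kp n N m θ := by
  set g : ℕ → ℝ := fun k => curveProfile μ S (msChain d Kp n N k) θ with hg
  have hsum : ∑ m ∈ Ioc n N, msProfile μ S d Kp n N m θ = ∑ i ∈ range (N - n), (g (i + 1) - g i) := by
    rw [(show Ioc n N = Ico (n + 1) (N + 1) by ext m; simp only [Finset.mem_Ioc, Finset.mem_Ico]; omega), Finset.sum_Ico_eq_sum_range, show N + 1 - (n + 1) = N - n by omega]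
    refine Finset.sum_congr rfl fun i hi => ?_
    have hi' := mem_range.mp hi
    have hne : n + 1 + i ≠ n := by omega
    have hmem : n + 1 + i ∈ Ioc n N := by rw [Finset.mem_Ioc]; omega
    simp only [msProfile, if_neg hne, if_pos hmem, hg]
    rw [show n + 1 + i - n = i + 1 by omega, show i + 1 - 1 = i by omega]
  rw [hsum, Finset.sum_range_sub, hg]
  simp only [msProfile, if_true, curveProfile]
  rw [klFermiPoint_msChain_last d hK hnN μ]
  ring

/-- The profiles are `2π`-periodic. -/
theorem msProfile_periodic (μ : ℝ) (S : TrigPolyC4v) (d : ℕ) (Kp : ℕ → TrigPolyC4v) (n N m : ℕ) :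
    Function.Periodic (msProfile μ S d Kp n N m) (2 * π) := by
  intro θ
  simp only [msProfile, curveProfile, klFermiPoint_periodic μ _ θ]

/-- The profiles are even. -/
theorem msProfile_even (μ : ℝ) (S : TrigPolyC4v) (d : ℕ) (Kp : ℕ → TrigPolyC4v) (n N m : ℕ) (θ : ℝ) :
    msProfile μ S d Kp n N m (-θ) = msProfile μ S d Kp n N m θ := by
  simp only [msProfile, curveProfile, klFermiPoint_neg, TrigPolyC4v.eval_reflect]

/-- The profiles are `θ ↦ π/2 − θ` symmetric. -/
theorem msProfile_diag (μ : ℝ) (S : TrigPolyC4v) (d : ℕ) (Kp : ℕ → TrigPolyC4v) (n N m : ℕ) (θ : ℝ) :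
    msProfile μ S d Kp n N m (π / 2 - θ) = msProfile μ S d Kp n N m θ := by
  simp only [msProfile, curveProfile, klFermiPoint_pi_div_two_sub, TrigPolyC4v.eval_swap]

/-- The profiles vanish off `{n} ∪ Ioc n N`. -/
theorem msProfile_of_not_mem {μ : ℝ} {S : TrigPolyC4v} {d : ℕ} {Kp : ℕ → TrigPolyC4v} {n N m : ℕ} (hm : m ≠ n)
    (hm' : m ∉ Ioc n N) : msProfile μ S d Kp n N m = fun _ => 0 := by
  funext θ; simp [msProfile, hm, hm']

end Summit.HubbardSuperconductivity.HubbardSuperconductivity.Theorems.KLRegimeSplit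

end
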